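import Mathlib
import Summits.ResolutionOfSingularities.ResolutionOfSingularities.Theorems.AbhyankarShadowsSemivaluationShadowsFrameShadow
import Summits.ResolutionOfSingularities.ResolutionOfSingularities.Theorems.AbhyankarShadowsSemivaluationShadowsExactSpecialisation
import Summits.ResolutionOfSingularities.ResolutionOfSingularities.Theorems.AbhyankarShadowsSemivaluationShadowsMinimalSpecialisation
import Summits.ResolutionOfSingularities.ResolutionOfSingularities.Theorems.AbhyankarShadowsSemivaluationShadowsEvalRationalFunctions
import Summits.ResolutionOfSingularities.ResolutionOfSingularities.Theorems.AbhyankarShadowsSemivaluationShadowsRankOneSaturation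
import Summits.ResolutionOfSingularities.ResolutionOfSingularities.Theorems.AbhyankarShadowsSemivaluationShadowsCyclicValueGroup
import Summits.ResolutionOfSingularities.ResolutionOfSingularities.Theorems.ShadowsUniformize.Negative.IdentityShadow
import Summits.ResolutionOfSingularities.ResolutionOfSingularities.Theorems.AbhyankarShadowsShadowsUniformizeLurelDiscrete
import HarnessLib

/-!
# Shadows of rational rank-one valuations on ruled function fields (`stub_ruledShadowsRankOne`)

Crux `SemivaluationShadows` (item `stmt-ResolutionOfSingularities-16757`, route `AbhyankarShadows`,
the EXISTENCE half of Teissier's semivaluation conjecture typed over finite sets), line `birth`,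
registered stub `stub_ruledShadowsRankOne`, PROVED: `ruledShadowsRankOne` (binder form, conclusion
`HasShadow O R F` unfolded) and `stub_ruledShadowsRankOne : Sig.stub_ruledShadowsRankOne` (the
registered signature; `HasShadow`, `Sig.stub_ruledShadowsRankOne` copied VERBATIM, `private`, from
the line skeleton `Cruxes/SemivaluationShadows/Lines/birth.lean`, which a Theorems file cannot import).

**Statement.** `k` algebraically closed of characteristic `p`, `K/k` finitely generated, `O ∋ k` a
RATIONAL valuation ring of `K` of rational rank one, and a RULED presentation `K = K₀(y)` (`y`
transcendental over `K₀`, `ν|K₀` discrete: `0 ≠ t ∈ K₀`, `ν t < 1`, all values on `K₀ˣ` powers of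
`ν t`), e.g. the plane `k(t, y)` or `k(C)(y)`: every finitely generated `R ⊆ O` and finite `F ⊆ R`
have a SHADOW exact on `F`.

**Proof (the minimal-approximant engine).** (1) `rankOneSaturation_of`: extend `ν` to `V` on an
algebraically closed `M ⊇ K` (values torsion over `ν t`, residues constants). (2) Write the
generators `g` of a model `R₀ ⊇ R` (`exists_fg_isFractionRing_le`), the `g - c_g` (`c_g` the residue
constant) and the elements of `F` as `P(y)/Q(y)` over `K₀`. (3)
`exists_minimal_exact_specialisation_of_algebra`: `ρ' ∈ M` ALGEBRAIC over `K₀` with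
`V(f(ρ')) = V(f(y))` for these `P, Q` AND for every `f ≠ 0` of degree `< [K₀(ρ') : K₀]`. (4)
`evalRationalFunctions`: `φ = ev_{y := ρ'}` on `K₀[y, P(y)/Q(y)]` is then EXACT on these elements.
(5) `L = K₀(ρ')` is finite over `K₀`, so `O' = V ∩ L` has cyclic value group
(`isCyclic_valueGroup_of_finite`) and a uniformiser `π = g_π(ρ')`, `deg g_π < [L : K₀]` (power
basis), whose lift `ẽ = g_π(y)` is exact by (3). (6) On the model `R₁ = k[g, ẽ]` the elements
congruent to one and the same constant modulo `𝔪_O` and modulo `𝔪_V ∘ φ` form a subalgebra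
containing the generators ([inside], [centre]); [rational'] is the residue clause of (1). (7)
`frameShadow` with the one-element frame `ẽ ↦ π`. Classically: minimal pairs / key polynomials on
`K₀(y)` (MacLane 1936; Alexandru–Popescu–Zaharescu). No named fact is used. [folklore]
-/

set_option linter.dupNamespace false

noncomputable section

open Polynomial Literature.AlgebraicGeometry.Resolution

namespace Summit.ResolutionOfSingularities.ResolutionOfSingularities.Theorems

/-- Products of elements congruent to constants (of value `≤ 1`) modulo the maximal ideal of a
valuation are congruent to the product of the constants. [folklore] -/
theorem RuledShadows.cong_mul {k E Γ : Type*} [Field k] [Field E] [Algebra k E]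
    [LinearOrderedCommGroupWithZero Γ] (v : Valuation E Γ) (hk1 : ∀ c : k, v (algebraMap k E c) ≤ 1)
    {x x' : E} {c c' : k} (h : v (x - algebraMap k E c) < 1) (h' : v (x' - algebraMap k E c') < 1) :
    v (x * x' - algebraMap k E (c * c')) < 1 := by
  have hx : v x ≤ 1 := by simpa using v.map_add_le h.le (hk1 c)
  rw [show x * x' - algebraMap k E (c * c') =
    (x' - algebraMap k E c') * x + (x - algebraMap k E c) * algebraMap k E c' by rw [map_mul]; ring]
  exact v.map_add_lt (by rw [map_mul]; exact mul_lt_one_of_lt_of_le h' hx)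
    (by rw [map_mul]; exact mul_lt_one_of_lt_of_le h (hk1 c'))

/-- An element congruent to the constant `c` modulo the maximal ideal lies in it iff `c = 0`
(non-zero constants having value `1`). [folklore] -/
theorem RuledShadows.lt_one_iff {k E Γ : Type*} [Field k] [Field E] [Algebra k E]
    [LinearOrderedCommGroupWithZero Γ] (v : Valuation E Γ)
    (hk1 : ∀ c : k, c ≠ 0 → v (algebraMap k E c) = 1) {x : E} {c : k}
    (h : v (x - algebraMap k E c) < 1) : v x < 1 ↔ c = 0 := by
  by_cases hc : c = 0
  · rw [hc, map_zero, sub_zero] at h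
    exact ⟨fun _ => hc, fun _ => h⟩
  · refine ⟨fun hx => absurd ?_ (lt_irrefl (1 : Γ)), fun h0 => absurd h0 hc⟩
    calc (1 : Γ) = v (x - (x - algebraMap k E c)) := by rw [sub_sub_cancel, hk1 c hc]
      _ < 1 := v.map_sub_lt hx h

/-- Corestriction of a `k`-algebra map to an intermediate field (over a bigger base `F₀ ⊇ k`)
containing its image. [folklore] -/
theorem RuledShadows.exists_corestrict {k F₀ M A : Type*} [Field k] [Field F₀] [Field M]
    [Algebra F₀ M] [Algebra k M] [Algebra k F₀] [IsScalarTower k F₀ M] [CommRing A] [Algebra k A]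
    (ψ : A →ₐ[k] M) (L : IntermediateField F₀ M) (h : ∀ a, ψ a ∈ L) :
    ∃ φ : A →ₐ[k] L, ∀ a, algebraMap L M (φ a) = ψ a :=
  ⟨{ toFun := fun a => ⟨ψ a, h a⟩
     map_one' := Subtype.ext (map_one ψ)
     map_mul' := fun a b => Subtype.ext (map_mul ψ a b)
     map_zero' := Subtype.ext (map_zero ψ)
     map_add' := fun a b => Subtype.ext (map_add ψ a b)
     commutes' := fun c => Subtype.ext (ψ.commutes c) }, fun _ => rfl⟩

set_option maxHeartbeats 400000 in
/-- **Shadows in the ruled rank-one case** (binder form of the registered stub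
`stub_ruledShadowsRankOne`, conclusion = the crux's `HasShadow O R F` unfolded; the saturation is
taken in any algebraically closed algebraic extension `M` of `K`, e.g. `AlgebraicClosure K`).
Proof in the module docstring. [folklore] -/
theorem ruledShadowsRankOne (p : ℕ) (hp : p.Prime) (k K : Type) [Field k] [CharP k p] [IsAlgClosed k]
    [Field K] [Algebra k K] (hfg : (⊤ : IntermediateField k K).FG) (O : ValuationSubring K)
    (hk : ∀ c : k, algebraMap k K c ∈ O)
    (hrat : ∀ x : K, x ∈ O → ∃ c : k, O.valuation (x - algebraMap k K c) < 1)
    (hrr : Module.finrank ℤ (Additive (O.ValueGroup)ˣ) = 1) (K₀ : IntermediateField k K)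
    (t y : K) (htK₀ : t ∈ K₀) (ht0 : t ≠ 0) (ht1 : O.valuation t < 1)
    (hdisc : ∀ x : K, x ∈ K₀ → x ≠ 0 → ∃ m : ℤ, O.valuation x = O.valuation t ^ m)
    (hy : Transcendental K₀ y) (hgen : IntermediateField.adjoin K₀ {y} = ⊤)
    (R : Subalgebra k K) (hR : R.FG) (hRO : R.toSubring ≤ O.toSubring) (F : Finset R)
    (M : Type) [Field M] [IsAlgClosed M] [Algebra K M] [Algebra k M] [IsScalarTower k K M]
    [Algebra.IsAlgebraic K M] :
    ∃ (R₁ : Subalgebra k K) (hle : R ≤ R₁) (_ : R₁.toSubring ≤ O.toSubring), R₁.FG ∧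
    IsFractionRing R₁ K ∧ ∃ (L : Type) (_ : Field L) (_ : Algebra k L) (φ : R₁ →ₐ[k] L)
    (O' : ValuationSubring L), Module.finrank ℤ (Additive (O'.ValueGroup)ˣ) =
      Module.finrank ℤ (Additive (O.ValueGroup)ˣ) ∧ (∀ y : R₁, φ y ∈ O') ∧
    (∀ y : R₁, O'.valuation (φ y) < 1 ↔ O.valuation (y : K) < 1) ∧
    (∀ z : L, z ∈ O' → ∃ c : k, O'.valuation (z - algebraMap k L c) < 1) ∧
    (MonoidHom.mrange (O'.valuation.toMonoidWithZeroHom.toMonoidHom.comp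
      φ.toRingHom.toMonoidHom)).FG ∧
    ∃ ι : O'.ValueGroup →*₀o O.ValueGroup, Function.Injective ι ∧
      (∀ y : R₁, φ y ≠ 0 → ∃ y' : R₁, ι (O'.valuation (φ y)) = O.valuation (y' : K)) ∧
      ∀ x ∈ F, ι (O'.valuation (φ (Subalgebra.inclusion hle x))) = O.valuation ((x : R) : K) := by
  classical
  have _hp := hp -- the characteristic plays no role in the ruled case
  have hkO1 : ∀ c : k, O.valuation (algebraMap k K c) ≤ 1 := fun c => O.valuation_le_one ⟨_, hk c⟩
  -- Step 1: saturation of `ν` in `M`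
  obtain ⟨V, hVO, htors, hres, hd, he, -⟩ := rankOneSaturation_of (M := M) O hk hrat hrr t ht0 ht1
  have hkV : ∀ c : k, algebraMap k M c ∈ V := fun c => by
    rw [IsScalarTower.algebraMap_apply k K M, ← ValuationSubring.mem_comap, hVO]; exact hk c
  have hkV1 : ∀ c : k, V.valuation (algebraMap k M c) ≤ 1 := fun c => V.valuation_le_one ⟨_, hkV c⟩
  -- Step 2: `K = K₀(y)`: every element is a fraction of polynomials in `y`; residue constants
  have hinj : Function.Injective (aeval y : K₀[X] →ₐ[K₀] K) := transcendental_iff_injective.mp hy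
  have haev0 : ∀ f : K₀[X], f ≠ 0 → aeval y f ≠ 0 := fun f hf => (map_ne_zero_iff _ hinj).mpr hf
  have hrep : ∀ z : K, ∃ P Q : K₀[X], Q ≠ 0 ∧ z * aeval y Q = aeval y P := fun z => by
    obtain ⟨r, s, hrs⟩ := (IntermediateField.mem_adjoin_simple_iff K₀ z).mp (by rw [hgen]; trivial)
    by_cases hs : aeval y s = 0
    · exact ⟨0, 1, one_ne_zero, by rw [hrs, hs, div_zero, zero_mul, map_zero]⟩
    · exact ⟨r, s, fun h => hs (by rw [h, map_zero]), by rw [hrs, div_mul_cancel₀ _ hs]⟩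
  choose P Q hQ0 hPQ using hrep
  have hPQ' : ∀ z : K, aeval y (P z) / aeval y (Q z) = z := fun z =>
    (eq_div_of_mul_eq (haev0 _ (hQ0 z)) (hPQ z)).symm
  choose! c hc using fun x (hx : x ∈ O) => hrat x hx
  -- Step 3: a first model `R₀ = k[s]` and the finite set of polynomials to be kept exact
  obtain ⟨R₀, hRR₀, hR₀O, ⟨s, hs⟩, hfrac₀⟩ :=
    ShadowsUniformize.Negative.exists_fg_isFractionRing_le hfg O hk R hR hRO
  haveI := hfrac₀
  let s₂ : Finset K := s ∪ s.image (fun g => g - algebraMap k K (c g)) ∪ F.image fun x => ((x : R) : K)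
  let S₀ : Finset K₀[X] := s₂.biUnion fun g => {P g, Q g}
  have hSmem : ∀ g ∈ s₂, P g ∈ S₀ ∧ Q g ∈ S₀ := fun g hg =>
    ⟨Finset.mem_biUnion.mpr ⟨g, hg, by simp⟩, Finset.mem_biUnion.mpr ⟨g, hg, by simp⟩⟩
  -- Step 4: the minimal approximant `ρ'`
  let t₀ : K₀ := ⟨t, htK₀⟩
  have ht₀M : algebraMap K₀ M t₀ = algebraMap K M t := IsScalarTower.algebraMap_apply K₀ K M t₀
  have htors' : ∀ z : M, z ≠ 0 → ∃ N : ℕ, N ≠ 0 ∧ ∃ b : K₀,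
      V.valuation z ^ N = V.valuation (algebraMap K₀ M b) := fun z hz => by
    obtain ⟨N, hN, m, hm⟩ := htors z hz
    exact ⟨N, hN, t₀ ^ m, by rw [map_zpow₀, map_zpow₀, ht₀M, hm]⟩
  have hres' : ∀ u : M, V.valuation u = 1 → ∃ b : K₀, V.valuation (u - algebraMap K₀ M b) < 1 :=
    fun u hu => (hres u hu).imp' (algebraMap k K₀) fun a ha => by
      rwa [← IsScalarTower.algebraMap_apply, IsScalarTower.algebraMap_apply k K M]
  obtain ⟨ρ', hρ'alg, hexS, hexdeg⟩ := exists_minimal_exact_specialisation_of_algebra (F₀ := K₀)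
    (M := M) V.valuation htors' hres'
    ((transcendental_algebraMap_iff (algebraMap K M).injective).mpr hy) (S₀.filter (· ≠ 0))
    (fun f hf => (Finset.mem_filter.mp hf).2)
  have hex : ∀ f ∈ S₀, V.valuation (aeval ρ' f) = V.valuation (algebraMap K M (aeval y f)) :=
    fun f hf => (eq_or_ne f 0).elim (fun hf0 => by simp only [hf0, map_zero]) fun hf0 => by
      rw [hexS f (Finset.mem_filter.mpr ⟨hf, hf0⟩), aeval_algebraMap_apply]
  have hexne : ∀ f ∈ S₀, f ≠ 0 → aeval ρ' f ≠ 0 := fun f hf hf0 h => haev0 f hf0 (by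
    have h' := hex f hf
    rwa [h, map_zero, eq_comm, map_eq_zero, map_eq_zero] at h')
  -- Step 5: the evaluation map `φ = ev_{y := ρ'}` on `D = K₀[y, g (g ∈ s₂)]`, exact on `s₂`
  let P' : Fin s₂.card → K₀[X] := fun i => P ((s₂.equivFin.symm i : s₂) : K)
  let Q' : Fin s₂.card → K₀[X] := fun i => Q ((s₂.equivFin.symm i : s₂) : K)
  let D : Subalgebra K₀ K :=
    Algebra.adjoin K₀ (insert y (Set.range fun i => aeval y (P' i) / aeval y (Q' i)))
  obtain ⟨φ, -, hφ⟩ : ∃ φ : D →ₐ[K₀] M, φ ⟨y, Algebra.subset_adjoin (Set.mem_insert _ _)⟩ = ρ' ∧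
      ∀ (z : D) (A B : K₀[X]), aeval ρ' B ≠ 0 → (z : K) * aeval y B = aeval y A →
        φ z = aeval ρ' A / aeval ρ' B :=
    evalRationalFunctions K₀ K M y hy ρ' _ P' Q' fun i =>
      hexne _ (hSmem _ (s₂.equivFin.symm i).2).2 (hQ0 _)
  have hpolyD : ∀ f : K₀[X], aeval y f ∈ D := fun f => Algebra.adjoin_le
    (Set.singleton_subset_iff.mpr (Algebra.subset_adjoin (Set.mem_insert _ _)))
    (aeval_mem_adjoin_singleton K₀ y)
  have hs₂D : ∀ g ∈ s₂, g ∈ D := fun g hg =>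
    Algebra.subset_adjoin (Set.mem_insert_of_mem _ ⟨s₂.equivFin ⟨g, hg⟩, by simp [P', Q', hPQ']⟩)
  have hφa : ∀ a : k, φ (algebraMap k D a) = algebraMap k M a := fun a => by
    rw [IsScalarTower.algebraMap_apply k K₀ D, φ.commutes, ← IsScalarTower.algebraMap_apply]
  have hexact : ∀ (g : K) (hg : g ∈ s₂),
      V.valuation (φ ⟨g, hs₂D g hg⟩) = V.valuation (algebraMap K M g) := fun g hg => by
    have hQρ : aeval ρ' (Q g) ≠ 0 := hexne _ (hSmem g hg).2 (hQ0 g)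
    rw [hφ ⟨g, hs₂D g hg⟩ (P g) (Q g) hQρ (hPQ g), map_div₀, hex _ (hSmem g hg).1,
      hex _ (hSmem g hg).2, ← map_div₀, ← map_div₀, hPQ']
  -- Step 6: `L = K₀(ρ')`, its valuation ring `O' = V ∩ L`, comparison with `ν`
  have hint : IsIntegral K₀ ρ' := hρ'alg.isIntegral
  let Lf : IntermediateField K₀ M := IntermediateField.adjoin K₀ {ρ'}
  haveI : FiniteDimensional K₀ Lf := IntermediateField.adjoin.finiteDimensional hint
  haveI : IsScalarTower k Lf M := IsScalarTower.of_algebraMap_eq fun _ => rfl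
  have hpolyL : ∀ f : K₀[X], aeval ρ' f ∈ Lf := fun f =>
    IntermediateField.algebra_adjoin_le_adjoin K₀ _ (aeval_mem_adjoin_singleton K₀ ρ')
  let O' : ValuationSubring Lf := V.comap (algebraMap Lf M)
  have hcmp : V.comap (algebraMap Lf M) = O' := rfl
  have hLt : ∀ (z : Lf) (x : K), V.valuation (algebraMap Lf M z) = V.valuation (algebraMap K M x) →
      (O'.valuation z < 1 ↔ O.valuation x < 1) := fun z x h => by
    rw [← valuation_map_lt_one_iff (algebraMap Lf M) hcmp, h, ← hd]
  have hEq : ∀ (z z' : Lf) (x x' : K),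
      V.valuation (algebraMap Lf M z) = V.valuation (algebraMap K M x) →
      V.valuation (algebraMap Lf M z') = V.valuation (algebraMap K M x') →
      (O'.valuation z = O'.valuation z' ↔ O.valuation x = O.valuation x') :=
    fun z z' x x' h h' => by rw [← valuation_map_eq_iff (algebraMap Lf M) hcmp, h, h', ← he]
  have hKL : ∀ x : K₀, algebraMap Lf M (algebraMap K₀ Lf x) = algebraMap K M x := fun x => by
    rw [← IsScalarTower.algebraMap_apply, IsScalarTower.algebraMap_apply K₀ K M]; rfl
  have hkL : ∀ a : k, algebraMap Lf M (algebraMap k Lf a) = algebraMap K M (algebraMap k K a) :=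
    fun a => by rw [← IsScalarTower.algebraMap_apply, IsScalarTower.algebraMap_apply k K M]
  -- `ν|K₀` discrete ⇒ the value group of `L` is cyclic ⇒ a uniformiser `π`
  have ht₀0 : algebraMap K₀ Lf t₀ ≠ 0 :=
    (map_ne_zero_iff _ (algebraMap K₀ Lf).injective).mpr fun h => ht0 (congrArg Subtype.val h)
  have ht₀1 : O'.valuation (algebraMap K₀ Lf t₀) < 1 := (hLt _ t (by rw [hKL])).mpr ht1
  have hcyc : IsCyclic (O'.ValueGroup)ˣ := isCyclic_valueGroup_of_finite O' t₀ ht₀0 fun x hx => by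
    obtain ⟨m, hm⟩ := hdisc x x.2 fun h => hx (Subtype.ext h)
    exact ⟨m, by rw [← map_zpow₀, hEq _ _ (x : K) (t ^ m) (by rw [hKL]) (by
      rw [map_zpow₀, map_zpow₀, hKL, ← map_zpow₀, ← map_zpow₀]), hm, map_zpow₀]⟩
  obtain ⟨π, hπ0, hπ1, hπgen⟩ := exists_uniformizer_of_isCyclic O' hcyc ⟨_, ht₀0, ht₀1.ne⟩
  have hπpos : 0 < O'.valuation π := (Valuation.pos_iff _).mpr hπ0
  -- `π = g_π(ρ')` with `deg g_π < [L : K₀]`, and its EXACT lift `ẽ = g_π(y)`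
  obtain ⟨gπ, hgπdeg, hgπ⟩ := (IntermediateField.adjoin.powerBasis hint).exists_eq_aeval π
  rw [IntermediateField.adjoin.powerBasis_dim] at hgπdeg
  have hπM : algebraMap Lf M π = aeval ρ' gπ := by
    rw [hgπ, IntermediateField.adjoin.powerBasis_gen, ← aeval_algebraMap_apply,
      IntermediateField.AdjoinSimple.algebraMap_gen]
  have hgπ0 : gπ ≠ 0 := fun h => hπ0 (by rw [hgπ, h, map_zero])
  set ee : K := aeval y gπ with hee
  have hee0 : ee ≠ 0 := haev0 _ hgπ0
  have heex : V.valuation (algebraMap Lf M π) = V.valuation (algebraMap K M ee) := by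
    rw [hπM, hexdeg gπ hgπ0 hgπdeg, aeval_algebraMap_apply]
  have hee1 : O.valuation ee < 1 := (hLt π ee heex).mp hπ1
  have heepos : 0 < O.valuation ee := (Valuation.pos_iff _).mpr hee0
  have heeD : ee ∈ D := hpolyD gπ
  have hφee : φ ⟨ee, heeD⟩ = algebraMap Lf M π := by
    rw [hπM, hφ ⟨ee, heeD⟩ gπ 1 (by rw [map_one]; exact one_ne_zero) (by rw [map_one, mul_one]),
      map_one, div_one]
  -- Step 7: the subalgebra `A` of BI-CONGRUENT elements of `D` (mapped into `L`, congruent to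
  -- one and the same constant modulo `𝔪_O` and modulo `𝔪_V ∘ φ`) and the model `R₁ = k[s, ẽ]`
  let Bi : K → Prop := fun x => ∃ w : D, (w : K) = x ∧ φ w ∈ Lf ∧ ∃ a : k,
    O.valuation (x - algebraMap k K a) < 1 ∧ V.valuation (φ w - algebraMap k M a) < 1
  have hBi : ∀ a : k, Bi (algebraMap k K a) := fun a =>
    ⟨algebraMap k D a, rfl, by rw [hφa, IsScalarTower.algebraMap_apply k Lf M]; exact (algebraMap k Lf a).2,
      a, by rw [sub_self, map_zero]; exact zero_lt_one,
      by rw [hφa, sub_self, map_zero]; exact zero_lt_one⟩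
  let A : Subalgebra k K :=
    { carrier := {x | Bi x}
      mul_mem' := by
        rintro _ _ ⟨w, rfl, hwL, a, ha, ha'⟩ ⟨w', rfl, hw'L, a', hb, hb'⟩
        exact ⟨w * w', rfl, by rw [map_mul]; exact mul_mem hwL hw'L, a * a',
          RuledShadows.cong_mul O.valuation hkO1 ha hb,
          by rw [map_mul]; exact RuledShadows.cong_mul V.valuation hkV1 ha' hb'⟩
      add_mem' := by
        rintro _ _ ⟨w, rfl, hwL, a, ha, ha'⟩ ⟨w', rfl, hw'L, a', hb, hb'⟩
        exact ⟨w + w', rfl, by rw [map_add]; exact add_mem hwL hw'L, a + a',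
          by rw [map_add, add_sub_add_comm]; exact O.valuation.map_add_lt ha hb,
          by rw [map_add, map_add, add_sub_add_comm]; exact V.valuation.map_add_lt ha' hb'⟩
      one_mem' := by simpa only [Set.mem_setOf_eq, map_one] using hBi 1
      zero_mem' := by simpa only [Set.mem_setOf_eq, map_zero] using hBi 0
      algebraMap_mem' := hBi }
  have hA : ∀ x : K, x ∈ A ↔ Bi x := fun _ => Iff.rfl
  have hsA : ∀ g ∈ s, g ∈ A := fun g hg => by
    have hg₂ : g ∈ s₂ := Finset.mem_union_left _ (Finset.mem_union_left _ hg)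
    have hg₃ : g - algebraMap k K (c g) ∈ s₂ :=
      Finset.mem_union_left _ (Finset.mem_union_right _ (Finset.mem_image.mpr ⟨g, hg, rfl⟩))
    have hgO : g ∈ O := hR₀O (show g ∈ R₀ from hs ▸ Algebra.subset_adjoin hg)
    refine (hA g).mpr ⟨⟨g, hs₂D g hg₂⟩, rfl, ?_, c g, hc g hgO, ?_⟩
    · rw [hφ ⟨g, hs₂D g hg₂⟩ (P g) (Q g) (hexne _ (hSmem g hg₂).2 (hQ0 g)) (hPQ g)]
      exact div_mem (hpolyL _) (hpolyL _)
    · rw [← hφa, ← map_sub, show (⟨g, hs₂D g hg₂⟩ : D) - algebraMap k D (c g) =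
        ⟨g - algebraMap k K (c g), hs₂D _ hg₃⟩ from Subtype.ext rfl, hexact _ hg₃, ← hd]
      exact hc g hgO
  have heeA : ee ∈ A := (hA ee).mpr ⟨⟨ee, heeD⟩, rfl, by rw [hφee]; exact π.2, 0,
    by rw [map_zero, sub_zero]; exact hee1,
    by rw [map_zero, sub_zero, hφee]; exact (valuation_map_lt_one_iff _ hcmp π).mpr hπ1⟩
  let R₁ : Subalgebra k K := Algebra.adjoin k (insert ee (s : Set K))
  have hR₁A : R₁ ≤ A := Algebra.adjoin_le (Set.insert_subset heeA fun g hg => hsA g hg)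
  have hR₀R₁ : R₀ ≤ R₁ := hs ▸ Algebra.adjoin_mono (Set.subset_insert _ _)
  have hle : R ≤ R₁ := hRR₀.trans hR₀R₁
  have h₁O : R₁.toSubring ≤ O.toSubring := fun x hx => by
    obtain ⟨-, -, -, a, ha, -⟩ := (hA x).mp (hR₁A hx)
    exact (O.valuation_le_one_iff _).mp (by simpa using O.valuation.map_add_le ha.le (hkO1 a))
  have hfrac : IsFractionRing R₁ K := IsFractionRing.of_field R₁ K fun z => by
    obtain ⟨a, b, -, hab⟩ := IsFractionRing.div_surjective (A := R₀) z
    exact ⟨⟨a, hR₀R₁ a.2⟩, ⟨b, hR₀R₁ b.2⟩, hab.symm⟩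
  -- Step 8: the shadow map `φL : R₁ → L` (evaluation at `y := ρ'`, corestricted)
  have hR₁D : R₁ ≤ D.restrictScalars k := fun x hx => by
    obtain ⟨w, hw, -⟩ := (hA x).mp (hR₁A hx)
    exact hw ▸ w.2
  let φ₁ : R₁ →ₐ[k] M := (D.ofRestrictScalars k φ).comp (Subalgebra.inclusion hR₁D)
  have hφ₁ : ∀ (z : R₁) (hz : (z : K) ∈ D), φ₁ z = φ ⟨z, hz⟩ := fun _ _ => rfl
  have hR₁L : ∀ z : R₁, φ₁ z ∈ Lf ∧ ∃ a : k, O.valuation ((z : K) - algebraMap k K a) < 1 ∧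
      V.valuation (φ₁ z - algebraMap k M a) < 1 := fun z => by
    obtain ⟨w, hw, hwL, a, ha, ha'⟩ := (hA z).mp (hR₁A z.2)
    rw [hφ₁ z (hw ▸ w.2), show (⟨(z : K), hw ▸ w.2⟩ : D) = w from Subtype.ext hw.symm]
    exact ⟨hwL, a, ha, ha'⟩
  obtain ⟨φL, hφL⟩ := RuledShadows.exists_corestrict φ₁ Lf fun z => (hR₁L z).1
  have hin : ∀ z : R₁, φL z ∈ O' := fun z => by
    obtain ⟨-, a, -, ha'⟩ := hR₁L z
    have h := V.valuation.map_add_le ha'.le (hkV1 a)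
    rw [sub_add_cancel, ← hφL, V.valuation_le_one_iff] at h
    exact ValuationSubring.mem_comap.mpr h
  have hcen : ∀ z : R₁, O'.valuation (φL z) < 1 ↔ O.valuation (z : K) < 1 := fun z => by
    obtain ⟨-, a, ha, ha'⟩ := hR₁L z
    rw [← valuation_map_lt_one_iff (algebraMap Lf M) hcmp, hφL,
      RuledShadows.lt_one_iff V.valuation (fun a ha => valuation_algebraMap_eq_one V hkV ha) ha',
      RuledShadows.lt_one_iff O.valuation (fun a ha => valuation_algebraMap_eq_one O hk ha) ha]
  have hrat' : ∀ z : Lf, z ∈ O' → ∃ a : k, O'.valuation (z - algebraMap k Lf a) < 1 := by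
    intro z hz
    rcases ((V.valuation_le_one_iff _).mpr (ValuationSubring.mem_comap.mp hz)).lt_or_eq with h1 | h1
    · exact ⟨0, by rwa [map_zero, sub_zero, ← valuation_map_lt_one_iff (algebraMap Lf M) hcmp]⟩
    · exact (hres _ h1).imp fun a ha => by
        rwa [← valuation_map_lt_one_iff (algebraMap Lf M) hcmp, map_sub, hkL]
  -- Step 9: the one-element frame `ẽ ↦ π` and the transfer
  let e : Fin 1 → R₁ := fun _ => ⟨ee, Algebra.subset_adjoin (Set.mem_insert _ _)⟩
  have hφLe : ∀ i, φL (e i) = π := fun i =>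
    (algebraMap Lf M).injective (by rw [hφL, hφ₁ _ heeD]; exact hφee)
  have hgen' : ∀ z : Lf, z ≠ 0 →
      ∃ m : Fin 1 → ℤ, O'.valuation z = ∏ i, O'.valuation (φL (e i)) ^ m i := fun z hz => by
    obtain ⟨m, hm⟩ := hπgen z hz
    exact ⟨fun _ => m, by rw [Fin.prod_univ_one, hφLe 0, hm]⟩
  have hind : ∀ m : Fin 1 → ℤ, (∏ i, O.valuation ((e i : R₁) : K) ^ m i) = 1 → m = 0 :=
    fun m hm => funext fun i => by
      rw [Fin.prod_univ_one] at hm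
      rw [Subsingleton.elim i 0]
      exact (zpow_eq_one_iff_right₀ zero_le hee1.ne).mp hm
  have hord : ∀ m : Fin 1 → ℤ, (∏ i, O'.valuation (φL (e i)) ^ m i) ≤ 1 ↔
      (∏ i, O.valuation ((e i : R₁) : K) ^ m i) ≤ 1 := fun m => by
    rw [Fin.prod_univ_one, Fin.prod_univ_one, hφLe 0, zpow_le_one_iff_right_of_lt_one₀ hπpos hπ1,
      zpow_le_one_iff_right_of_lt_one₀ heepos hee1]
  have h5 : ∀ z : R₁, φL z ≠ 0 →
      ∃ m : Fin 1 → ℕ, O'.valuation (φL z) = ∏ i, O'.valuation (φL (e i)) ^ m i := fun z hz => by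
    obtain ⟨m, hm⟩ := hπgen _ hz
    have hm0 : 0 ≤ m :=
      (zpow_le_one_iff_right_of_lt_one₀ hπpos hπ1).mp (hm ▸ (O'.valuation_le_one_iff _).mpr (hin z))
    refine ⟨fun _ => m.toNat, ?_⟩
    rw [Fin.prod_univ_one, hφLe 0, hm, ← zpow_natCast, Int.toNat_of_nonneg hm0]
  have hexF : ∀ x ∈ F, ((x : R) : K) ≠ 0 → φL (Subalgebra.inclusion hle x) ≠ 0 ∧
      ∃ m : Fin 1 → ℤ, O'.valuation (φL (Subalgebra.inclusion hle x)) =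
        ∏ i, O'.valuation (φL (e i)) ^ m i ∧
        O.valuation ((x : R) : K) = ∏ i, O.valuation ((e i : R₁) : K) ^ m i := by
    intro x hxF hx0
    have hx₂ : ((x : R) : K) ∈ s₂ := Finset.mem_union_right _ (Finset.mem_image.mpr ⟨x, hxF, rfl⟩)
    have hxV : V.valuation (algebraMap Lf M (φL (Subalgebra.inclusion hle x))) =
        V.valuation (algebraMap K M ((x : R) : K)) := by
      rw [hφL, hφ₁ _ (hs₂D _ hx₂)]
      exact hexact _ hx₂
    have hne : φL (Subalgebra.inclusion hle x) ≠ 0 := fun h0 => hx0 (by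
      rwa [h0, map_zero, map_zero, eq_comm, map_eq_zero, map_eq_zero] at hxV)
    obtain ⟨m, hm⟩ := hπgen _ hne
    refine ⟨hne, fun _ => m, by rw [Fin.prod_univ_one, hφLe 0, hm], ?_⟩
    rw [Fin.prod_univ_one, show ((e 0 : R₁) : K) = ee from rfl, ← map_zpow₀, ← hEq (φL (Subalgebra.inclusion hle x)) (π ^ m) _ (ee ^ m) hxV
      (by rw [map_zpow₀, map_zpow₀, heex, ← map_zpow₀, ← map_zpow₀]), hm, map_zpow₀]
  exact frameShadow k K O hk hrat 1 hrr R R₁ hle h₁O ⟨insert ee s, by rw [Finset.coe_insert]⟩ hfrac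
    Lf φL O' hin hcen hrat' e (fun _ => hee0) (fun i => by rw [hφLe i]; exact hπ0) hgen' hind
    hord h5 F hexF

/-! ## The registered stub signature, by name (`HasShadow`, `Sig.stub_ruledShadowsRankOne` copied
VERBATIM from the line skeleton `Cruxes/SemivaluationShadows/Lines/birth.lean`, `private`) -/

/-- VERBATIM copy of the skeleton's `HasShadow O R F` (a predicate of the line skeleton, not a named
fact): the `∃`-tail of the crux for one datum — a shadow `(R₁, L, φ, O', ι)` of `(R, O)` exact on
the finite set `F`. -/
private def HasShadow {k K : Type} [Field k] [Field K] [Algebra k K] (O : ValuationSubring K)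
    (R : Subalgebra k K) (F : Finset R) : Prop :=
  ∃ (R₁ : Subalgebra k K) (hle : R ≤ R₁) (_ : R₁.toSubring ≤ O.toSubring), R₁.FG ∧
    IsFractionRing R₁ K ∧ ∃ (L : Type) (_ : Field L) (_ : Algebra k L) (φ : R₁ →ₐ[k] L)
    (O' : ValuationSubring L), Module.finrank ℤ (Additive (O'.ValueGroup)ˣ) =
      Module.finrank ℤ (Additive (O.ValueGroup)ˣ) ∧ (∀ y : R₁, φ y ∈ O') ∧
    (∀ y : R₁, O'.valuation (φ y) < 1 ↔ O.valuation (y : K) < 1) ∧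
    (∀ z : L, z ∈ O' → ∃ c : k, O'.valuation (z - algebraMap k L c) < 1) ∧
    (MonoidHom.mrange (O'.valuation.toMonoidWithZeroHom.toMonoidHom.comp
      φ.toRingHom.toMonoidHom)).FG ∧
    ∃ ι : O'.ValueGroup →*₀o O.ValueGroup, Function.Injective ι ∧
      (∀ y : R₁, φ y ≠ 0 → ∃ y' : R₁, ι (O'.valuation (φ y)) = O.valuation (y' : K)) ∧
      ∀ x ∈ F, ι (O'.valuation (φ (Subalgebra.inclusion hle x))) = O.valuation ((x : R) : K)

/-- VERBATIM copy of the skeleton's registered signature `Sig.stub_ruledShadowsRankOne` (the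
statement of the stub, PROVED below as `stub_ruledShadowsRankOne` — not a named fact): shadows exist
for rational rank-one valuations of ruled function fields `K = K₀(y)`, `ν|K₀` discrete. -/
private def Sig.stub_ruledShadowsRankOne : Prop :=
  ∀ p : ℕ, p.Prime → ∀ (k K : Type) [Field k] [CharP k p] [IsAlgClosed k] [Field K] [Algebra k K],
    (⊤ : IntermediateField k K).FG → ∀ (O : ValuationSubring K)
    (hk : ∀ c : k, algebraMap k K c ∈ O),
    (∀ x : K, x ∈ O → ∃ c : k, O.valuation (x - algebraMap k K c) < 1) →
    Module.finrank ℤ (Additive (O.ValueGroup)ˣ) = 1 →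
    ∀ (K₀ : IntermediateField k K) (t y : K), t ∈ K₀ → t ≠ 0 → O.valuation t < 1 →
    (∀ x : K, x ∈ K₀ → x ≠ 0 → ∃ m : ℤ, O.valuation x = O.valuation t ^ m) →
    Transcendental K₀ y → IntermediateField.adjoin K₀ {y} = ⊤ →
    ∀ R : Subalgebra k K, R.FG → R.toSubring ≤ O.toSubring → ∀ F : Finset R, HasShadow O R F

/-- **STUB `stub_ruledShadowsRankOne` of line `birth` of crux `SemivaluationShadows`, PROVED**
(registered signature `Sig.stub_ruledShadowsRankOne`, by name; it unfolds to the skeleton's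
statement verbatim): `ruledShadowsRankOne` with `M := AlgebraicClosure K`. [folklore] -/
theorem stub_ruledShadowsRankOne : Sig.stub_ruledShadowsRankOne :=
  fun p hp k K _ _ _ _ _ hfg O hk hrat hrr K₀ t y htK₀ ht0 ht1 hdisc hy hgen R hR hRO F =>
    ruledShadowsRankOne p hp k K hfg O hk hrat hrr K₀ t y htK₀ ht0 ht1 hdisc hy hgen R hR hRO F
      (AlgebraicClosure K)

end Summit.ResolutionOfSingularities.ResolutionOfSingularities.Theorems

end
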